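import Summits.Ventures.PercRepro.RankLevelSetContractMonoCore
import Summits.Ventures.PercRepro.RankLevelSetContractMonoQOne
import Summits.Ventures.PercRepro.RankLevelSetBAll

/-!
# PercRepro — the (MC)-induction LEVEL BY LEVEL, and the `q = 1` row of C-025 re-derived through C-037 (night-1, gen 7)

`c025_level_of_contractMonoExistsCore`: for a fixed level `q ≥ 1`, given C-025 at level `q − 1` (every matroid,
every `p ≥ q + 1`) and C-037 (the existential contraction monotonicity) on the simple coloop-free rank-`p` cores
with every element `e`-free and `|E| > p + q` AT LEVEL `q` ONLY, C-025 holds at level `q` for every finite matroid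
and every `p ≥ q + 2`.  The induction is `rls_succ_all` of RankLevelSetFrameQ with the core case closed by the
element of C-037 and the same-level induction hypothesis on the contraction (simplicity in the `encard ≤ 2` form,
so that `exists_loop_or_parallel_of_not_simple` provides the case split).

`c025_q_one_of_contractMono`: **C-025 at `q = 1` for every finite matroid, derived through C-037** — the level
theorem at `q = 1` with Theorem A (`c025_of_q_zero`) at level `0` and `contractMono_q_one` (the proved `q = 1` row
of C-037) on the cores.  This is a second, independent kernel derivation of Theorem B: p3's Theorem B′ (the
level-wise count on simple matroids) is not used, only the lemma `ncard_U_one_le_of_eRank_eq` and the wrapper.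
Axioms: standard.
-/

open scoped Matroid

namespace PercRepro

namespace ThmN

open Set

variable {α : Type}

/-- The simple-form hypothesis in the `encard` spelling gives rank `2` to every pair. -/
lemma eRk_pair_eq_two_of_simple' (M : Matroid α) (hsimple : ∀ T ⊆ M.E, T.encard ≤ 2 → M.Indep T)
    {e f : α} (he : e ∈ M.E) (hf : f ∈ M.E) (hef : e ≠ f) : M.eRk {e, f} = 2 := by
  have hind : M.Indep ({e, f} : Set α) :=
    hsimple _ (Set.insert_subset he (Set.singleton_subset_iff.2 hf)) (by rw [Set.encard_pair hef])
  rw [hind.eRk_eq_encard, Set.encard_pair hef]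

/-- Simplicity (`encard` form) passes to the truncation to rank `p ≥ 2`. -/
lemma truncate_simple (M : Matroid α) [M.Finite] {p : ℕ} (hp : 2 ≤ p)
    (hsimple : ∀ T ⊆ M.E, T.encard ≤ 2 → M.Indep T) :
    ∀ T ⊆ (Matroid.truncate M p).E, T.encard ≤ 2 → (Matroid.truncate M p).Indep T := by
  intro T hT hT2
  rw [Matroid.truncate_ground] at hT
  rw [Matroid.truncate_indep_iff]
  refine ⟨hsimple T hT hT2, ?_⟩
  have hTfin : T.Finite := Set.finite_of_encard_le_coe hT2
  have : (T.ncard : ℕ∞) ≤ 2 := by rw [hTfin.cast_ncard_eq]; exact hT2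
  have h2 : T.ncard ≤ 2 := by exact_mod_cast this
  omega

/-- **THE (MC)-INDUCTION AT ONE LEVEL**: C-025 at level `q − 1` (all `p ≥ q + 1`) and C-037 on the cores at level
`q` give C-025 at level `q` for every finite matroid and every `p ≥ q + 2`. -/
theorem c025_level_of_contractMonoExistsCore (q : ℕ) (hq : 1 ≤ q)
    (hprev : ∀ {α : Type} (M : Matroid α) [M.Finite] (p : ℕ), q + 1 ≤ p → RLS M p (q - 1))
    (hcore : ∀ {α : Type} (M : Matroid α) [M.Finite] (p : ℕ), q + 2 ≤ p →
      (∀ T ⊆ M.E, T.encard ≤ 2 → M.Indep T) → M.eRank = (p : ℕ∞) → (∀ e, ¬ M.IsColoop e) →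
      (∀ e ∈ M.E, ∃ A ⊆ M.E \ {e}, e ∉ M.closure A ∧ e ∉ M.closure ((M.E \ {e}) \ A)) →
      p + q < M.E.ncard → ∃ e, M.IsNonloop e ∧ Matroid.slack (M ／ {e}) (p - 1) q ≤ Matroid.slack M p q) :
    ∀ {α : Type} (M : Matroid α) [M.Finite] (p : ℕ), q + 2 ≤ p → RLS M p q := by
  suffices H : ∀ n : ℕ, ∀ {α : Type} (M : Matroid α) [M.Finite], M.E.ncard = n → ∀ p : ℕ, q + 2 ≤ p →
      RLS M p q by
    intro α M _ p hpq
    exact H _ M rfl p hpq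
  intro n
  induction n using Nat.strong_induction_on with
  | _ n ih =>
  intro α M _ hn p hpq
  classical
  obtain ⟨q', rfl⟩ : ∃ q', q = q' + 1 := ⟨q - 1, by omega⟩
  rw [Nat.add_sub_cancel] at hprev
  have hdel : ∀ e ∈ M.E, (M ＼ {e}).E.ncard < n := by
    intro e he
    rw [_root_.Matroid.delete_ground, ← hn, ← Set.ncard_sdiff_singleton_add_one he M.ground_finite]
    omega
  have hcon : ∀ e ∈ M.E, (M ／ {e}).E.ncard < n := by
    intro e he
    rw [_root_.Matroid.contract_ground, ← hn, ← Set.ncard_sdiff_singleton_add_one he M.ground_finite]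
    omega
  by_cases hsimple : ∀ T ⊆ M.E, T.encard ≤ 2 → M.Indep T
  · -- simple: the tight layer and below, then the rank trichotomy
    rcases lt_trichotomy M.E.ncard (p + (q' + 1)) with hsmall | htight | hbig
    · exact RLS_of_ncard_lt M hsmall
    · exact RLS_of_ncard_eq M htight
    rcases lt_trichotomy M.eRank (p : ℕ∞) with hlt | heq | hgt
    · exact RLS_of_eRank_lt M hlt
    · by_cases hC : ∃ e, M.IsColoop e
      · obtain ⟨e, hcol⟩ := hC
        obtain ⟨p', rfl⟩ : ∃ p', p = p' + 1 := ⟨p - 1, by omega⟩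
        refine RLS_of_coloop_q M (by omega) hcol heq ?_
        rcases Nat.lt_or_ge (q' + 2) p' with h | h
        · exact ih _ (hdel e hcol.mem_ground) (M ＼ {e}) rfl p' (by omega)
        · exact RLS_of_le (M ＼ {e}) (by omega)
      · push Not at hC
        by_cases hU : ∃ e ∈ M.E, ∀ A ⊆ M.E \ {e}, e ∈ M.closure A ∨ e ∈ M.closure ((M.E \ {e}) \ A)
        · obtain ⟨e, he, hunsp⟩ := hU
          have heI : M.Indep {e} := hsimple {e} (Set.singleton_subset_iff.2 he) (by
            rw [Set.encard_singleton]; norm_num)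
          obtain ⟨p', rfl⟩ : ∃ p', p = p' + 1 := ⟨p - 1, by omega⟩
          exact RLS_of_unspanned_q M heI hunsp (ih _ (hdel e he) (M ＼ {e}) rfl (p' + 1) hpq)
            (hprev (M ／ {e}) p' (by omega))
        · push Not at hU
          obtain ⟨e, he, hMC⟩ := hcore M p hpq hsimple heq hC (fun e he => by
            obtain ⟨A, hA, h⟩ := hU e he
            exact ⟨A, hA, h.1, h.2⟩) hbig
          exact RLS_of_contract_slack M hpq hMC
            (fun hp => ih _ (hcon e he.mem_ground) (M ／ {e}) rfl (p - 1) hp)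
    · -- `ρ(E) > p`: truncate
      have hp2 : 2 ≤ p := by omega
      set T := Matroid.truncate M p with hTdef
      have hTs := truncate_simple M hp2 hsimple
      have hTR := truncate_eRank_eq M hgt
      have hTc := truncate_no_coloop M hgt
      have hTE : T.E = M.E := Matroid.truncate_ground M p
      have hTn : T.E.ncard = n := by rw [hTE, hn]
      have hTbig : p + (q' + 1) < T.E.ncard := by rw [hTE]; exact hbig
      have hconT : ∀ e ∈ T.E, (T ／ {e}).E.ncard < n := by
        intro e he
        rw [_root_.Matroid.contract_ground, ← hTn, ← Set.ncard_sdiff_singleton_add_one he T.ground_finite]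
        omega
      have hdelT : ∀ e ∈ T.E, (T ＼ {e}).E.ncard < n := by
        intro e he
        rw [_root_.Matroid.delete_ground, ← hTn, ← Set.ncard_sdiff_singleton_add_one he T.ground_finite]
        omega
      have hT : RLS T p (q' + 1) := by
        by_cases hU : ∃ e ∈ T.E, ∀ A ⊆ T.E \ {e}, e ∈ T.closure A ∨ e ∈ T.closure ((T.E \ {e}) \ A)
        · obtain ⟨e, he, hunsp⟩ := hU
          have heT : T.Indep {e} := hTs {e} (Set.singleton_subset_iff.2 he) (by
            rw [Set.encard_singleton]; norm_num)
          obtain ⟨p', rfl⟩ : ∃ p', p = p' + 1 := ⟨p - 1, by omega⟩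
          exact RLS_of_unspanned_q T heT hunsp (ih _ (hdelT e he) (T ＼ {e}) rfl (p' + 1) hpq)
            (hprev (T ／ {e}) p' (by omega))
        · push Not at hU
          obtain ⟨e, he, hMC⟩ := hcore T p hpq hTs hTR hTc (fun e he => by
            obtain ⟨A, hA, h⟩ := hU e he
            exact ⟨A, hA, h.1, h.2⟩) hTbig
          exact RLS_of_contract_slack T hpq hMC
            (fun hp => ih _ (hconT e he.mem_ground) (T ／ {e}) rfl (p - 1) hp)
      unfold RLS at hT ⊢
      exact Matroid.rls_of_truncate M p (by omega) (phiK p (q' + 1)) (by unfold phiK; positivity) hT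
  · -- not simple: a loop or a parallel pair
    rcases exists_loop_or_parallel_of_not_simple hsimple with ⟨e, he, -⟩ | ⟨e, e', heE, he'E, hne, heI, hpar⟩
    · have heE : e ∈ M.E := M.closure_subset_ground _ he
      exact RLS_of_loop_q M he p (q' + 1) (ih _ (hdel e heE) (M ＼ {e}) rfl p hpq)
    · obtain ⟨p', rfl⟩ : ∃ p', p = p' + 1 := ⟨p - 1, by omega⟩
      exact RLS_of_parallel_q M heI he'E hne hpar (ih _ (hdel e heE) (M ＼ {e}) rfl (p' + 1) hpq)
        (hprev (M ／ {e}) p' (by omega))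

/-- **C-025 AT `q = 1` FOR EVERY FINITE MATROID, THROUGH C-037**: Theorem A at level `0` and the proved `q = 1` row
of the contraction monotonicity on the cores. -/
theorem c025_q_one_of_contractMono {α : Type} (M : Matroid α) [M.Finite] (p : ℕ) (hp : 3 ≤ p) :
    RLS M p 1 := by
  refine c025_level_of_contractMonoExistsCore 1 le_rfl ?_ ?_ M p hp
  · intro α M _ p _
    exact c025_of_q_zero (M := M) p
  · intro α M _ p hp hsimple hR hcol _ hn
    -- a matroid of rank `p ≥ 3` has a non-loop
    have hne : ∃ e, M.IsNonloop e := by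
      by_contra hno
      push Not at hno
      have hloop : ∀ e ∈ M.E, M.IsLoop e := fun e he =>
        (M.isLoop_or_isNonloop e he).resolve_right (hno e)
      have h0 : M.eRk M.E = 0 := by
        rw [Matroid.eRk_eq_zero_iff Subset.rfl]
        intro x hx
        exact hloop x hx
      rw [← Matroid.eRank_def] at h0
      rw [h0] at hR
      have : p = 0 := by exact_mod_cast hR.symm
      omega
    obtain ⟨e, he⟩ := hne
    exact ⟨e, he, Matroid.contractMono_q_one hsimple hp hR hcol (by omega) he⟩

end ThmN

end PercRepro
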